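import Summits.Ventures.CertifiedManyBodySolver.Downfold.EmeryBilinearRegion
import Summits.Ventures.CertifiedManyBodySolver.Downfold.EmeryVanHoveDoping
import Summits.Ventures.CertifiedManyBodySolver.Downfold.EmeryFermiSurfaceScaleSign
import HarnessLib

/-!
# The van Hove (Lifshitz) hole doping of the σ three-band model FACTORISES through the Fermi-surface ratio:
# `x_VH(Δ, t_pd, t_pp, t_pp′) = 1 − 2·Ψ(q)` with ONE number `q` and a UNIVERSAL antitone `Ψ`

Venture CertifiedManyBodySolver, cell `pub/hubbard-downfold` (stage S1, HUMAN RULINGS D-0096/D-0098: the three-band → one-band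
reduction error is carried explicitly), seat hubbard-downfold-mod-4 (technique B = band level); namespace
`Summit.Ventures.CertifiedManyBodySolver.Downfold.Emery`. Everything here is PROVED. WHAT THIS IS NOT: a statement about any
material; no number lives here; `U = 0` band kinematics of the σ model (`bloch4`); the identification of a material's LIFSHITZ
transition with this one-body crossing is the consumer's modelling claim.

`EmeryVanHoveDoping` defines `x_VH = 1 − 2·abFilling(ε_VH)`, `ε_VH = ε_AB(X) = abX(Δ + 4t_pp′, t_pd)`, and records (precision note)
that a sub-box rule which DECOUPLES `ε_VH(p)` from `p` is useless (windows ≈ [−0.2, 0.55] around a truth ≈ [0.14, 0.27]). This file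
removes the decoupling EXACTLY:

* §1 two cubic lemmas: the non-strict Taylor criterion `p(μ) ≥ 0 ∧ p′(μ) ≥ 0 ∧ p″(μ) ≥ 0 ⇒ topRoot ≤ μ`
  (`topRoot_le_of_taylor_nonneg`, `abBand_le_of_taylor_nonneg`, via `EmeryFermiSurfaceScaleSign.dcharCubic_eq_deriv`), and
  `ε_AB ≤ ε ⇒ charCubic(ε) ≥ 0` (`charCubic_nonneg_of_abBand_le`).
* §2 AT THE SADDLE ENERGY the k-independent coefficient of the bilinear secular function equals four times the nearest-neighbour
  weight: `cA(ε_VH) = 4·fsD(ε_VH)` (`cA_vhEnergy`, from `charCubic_at_X`); hence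
  `charCubic(x, y, ε_VH) = fsD(ε_VH)·(4 − 4(x + y) − 16q·xy)` with `q = vhRatio = fsN/fsD (ε_VH)` (`charCubic_vhEnergy_eq_bilin`);
  the identity `ε_VH·fsD(ε_VH) = 4(t_pd² − t_pp′ε_VH)²` (`vhEnergy_mul_fsD`) gives the CLOSED FORM `q = u(1 + u)`,
  `u = vhU = ε_VH(t_pp + t_pp′)/(2(t_pd² − t_pp′ε_VH))` (`vhRatio_eq_vhU`) — monotone in every argument; and
  `q = ρ/(1 − 2ρ)` with `ρ = −fsRatio(ε_VH)` the Fermi-surface `−t′/t` at the saddle energy (`vhRatio_eq_of_fsRatio`).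
* §3 THE SET IDENTITY: `{k : ε_AB(k) ≤ ε_VH} ⊆ bilinRegion 4 1 q` always (`abOccSet_vh_subset`, `fsD(ε_VH) > 0`), with EQUALITY
  under the separation condition `VHSep` (`∂_ε charCubic(ε_VH) ≥ 0` on the triangle `x + y ≤ 1`, which contains the region):
  `abOccSet_vh_eq`. Hence `abFilling(ε_VH) = Ψ(q)` with `Ψ = vhFrac = bilinFrac 4 1` UNIVERSAL and ANTITONE (`vhFrac_anti`),
  **`x_VH = 1 − 2·Ψ(q)`** (`xVH_eq`), and unconditionally `x_VH ≥ 1 − 2·Ψ(q)` (`xVH_ge`). `Ψ(q)` is the per-spin filling at which a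
  `t–t′` one-band model with `−t′/t = ρ = q/(1 + 2q)` reaches its own saddle point (the region is `{cos kx + cos ky ≥ 2ρ(1 + cos kx cos ky)}`).
* companion `EmeryVanHoveSubBox`: THE SUB-BOX RULE — ONE rational check per parameter sub-box certifies the `ε_VH`- and `q`-brackets,
  `VHSep` and the `x_VH` window; `EmeryVanHoveTable`: the certified table of `Ψ`. No grid count depends on the material.

Sources: three-band model [HybertsenSchluterChristensen1989, Eq. (1)]; saddle point of the `t–t′` form at X and the `(x, y)` contour
language [AndersenEtAl1995, §6]; interval arithmetic [folklore] (Moore 1966).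
-/

noncomputable section

namespace Summit.Ventures.CertifiedManyBodySolver.Downfold.Emery

open Real MeasureTheory Set

/-! ## §1 Two cubic lemmas -/

/-- NON-STRICT UPPER ENCLOSURE CRITERION: `p(μ) ≥ 0`, `p′(μ) ≥ 0`, `p″(μ)/2 = 3μ + a ≥ 0` ⇒ the monic cubic is positive on
`(μ, ∞)`, hence `topRoot ≤ μ`. [folklore] -/
theorem topRoot_le_of_taylor_nonneg {a b d μ : ℝ} (h0 : 0 ≤ monicCubic a b d μ)
    (h1 : 0 ≤ 3 * μ ^ 2 + 2 * a * μ + b) (h2 : 0 ≤ 3 * μ + a) : topRoot a b d ≤ μ := by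
  by_contra hlt
  have hlt' : μ < topRoot a b d := lt_of_not_ge hlt
  have hroot := monicCubic_topRoot a b d
  set r := topRoot a b d
  have hrm : 0 < r - μ := by linarith
  have ht := monicCubic_taylor a b d μ r
  have : 0 < monicCubic a b d r := by
    rw [ht]
    have e1 : 0 ≤ (3 * μ ^ 2 + 2 * a * μ + b) * (r - μ) := mul_nonneg h1 hrm.le
    have e2 : 0 ≤ (3 * μ + a) * (r - μ) ^ 2 := mul_nonneg h2 (sq_nonneg _)
    have e3 : 0 < (r - μ) ^ 3 := pow_pos hrm 3
    linarith
  linarith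

/-- NON-STRICT UPPER ENCLOSURE for the band: `charCubic(μ) ≥ 0`, `∂_ε charCubic(μ) ≥ 0`, `3μ + cubA ≥ 0 ⇒ ε_AB ≤ μ`.
[folklore] -/
theorem abBand_le_of_taylor_nonneg {Δ tpd tpp c x y μ : ℝ} (h0 : 0 ≤ charCubic Δ tpd tpp c x y μ)
    (h1 : 0 ≤ dcharCubic Δ tpd tpp c x y μ) (h2 : 0 ≤ 3 * μ + cubA Δ c x y) : abBand Δ tpd tpp c x y ≤ μ := by
  rw [charCubic_eq_monicCubic] at h0
  rw [dcharCubic_eq_deriv] at h1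
  exact topRoot_le_of_taylor_nonneg h0 h1 h2

/-- Above the antibonding band the secular cubic is non-negative: `ε_AB ≤ ε ⇒ 0 ≤ charCubic(ε)`. [folklore] -/
theorem charCubic_nonneg_of_abBand_le {Δ tpd tpp c x y ε : ℝ} (h : abBand Δ tpd tpp c x y ≤ ε) :
    0 ≤ charCubic Δ tpd tpp c x y ε := by
  rcases h.lt_or_eq with hlt | heq
  · by_contra hneg
    have hle : ε ≤ abBand Δ tpd tpp c x y := le_abBand_of_charCubic_nonpos (le_of_not_ge hneg)
    linarith
  · rw [← heq, charCubic_abBand]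

/-! ## §2 At the saddle energy: `cA = 4·fsD`, the ratio `q`, its closed form `u(1 + u)` -/

/-- `ε_VH > 0` as soon as `t_pd ≠ 0`. [folklore] -/
theorem vhEnergy_pos (Δ : ℝ) {tpd : ℝ} (htpd : tpd ≠ 0) (c : ℝ) : 0 < vhEnergy Δ tpd c := by
  have hq := vhEnergy_quad Δ tpd c
  have h0 := vhEnergy_nonneg Δ tpd c
  rcases h0.lt_or_eq with h | h
  · exact h
  · exfalso
    rw [← h] at hq
    have : tpd ^ 2 = 0 := by nlinarith
    exact htpd (pow_eq_zero_iff (n := 2) (by norm_num) |>.1 this)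

/-- **AT THE SADDLE ENERGY `cA = 4·fsD`**: the constant-energy contour through X = (π, 0) (`x = 1, y = 0`) has
`charCubic(1, 0, ε_VH) = cA − 4fsD = 0`. [folklore] -/
theorem cA_vhEnergy (Δ tpd c : ℝ) : cA Δ (vhEnergy Δ tpd c) = 4 * fsD Δ tpd c (vhEnergy Δ tpd c) := by
  have hq := vhEnergy_quad Δ tpd c
  set v := vhEnergy Δ tpd c
  unfold cA fsD
  have : v * (Δ + v) ^ 2 - 4 * ((Δ + v) * (tpd ^ 2 - c * v)) = (Δ + v) * (v ^ 2 + (Δ + 4 * c) * v - 4 * tpd ^ 2) := by ring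
  rw [hq, mul_zero] at this
  linarith

/-- The secular cubic AT THE SADDLE ENERGY: `charCubic(x, y, ε_VH) = 4fsD·(1 − (x + y)) − 16fsN·xy`. [folklore] -/
theorem charCubic_vhEnergy (Δ tpd tpp c x y : ℝ) :
    charCubic Δ tpd tpp c x y (vhEnergy Δ tpd c) =
      4 * fsD Δ tpd c (vhEnergy Δ tpd c) * (1 - (x + y)) - 16 * fsN tpd tpp c (vhEnergy Δ tpd c) * (x * y) := by
  rw [charCubic_bilinear, cA_vhEnergy]; ring

/-- `ε_VH·fsD(ε_VH) = 4(t_pd² − t_pp′·ε_VH)²` (eliminate `Δ + ε_VH = 4(t_pd² − t_pp′ε_VH)/ε_VH`). [folklore] -/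
theorem vhEnergy_mul_fsD (Δ tpd c : ℝ) :
    vhEnergy Δ tpd c * fsD Δ tpd c (vhEnergy Δ tpd c) = 4 * (tpd ^ 2 - c * vhEnergy Δ tpd c) ^ 2 := by
  have hq := vhEnergy_quad Δ tpd c
  set v := vhEnergy Δ tpd c
  unfold fsD
  have : v * (Δ + v) = 4 * (tpd ^ 2 - c * v) := by linarith
  calc v * ((Δ + v) * (tpd ^ 2 - c * v)) = (v * (Δ + v)) * (tpd ^ 2 - c * v) := by ring
    _ = 4 * (tpd ^ 2 - c * v) ^ 2 := by rw [this]; ring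

/-- THE VAN HOVE RATIO `q = fsN(ε_VH)/fsD(ε_VH)`: the single number through which the saddle-energy occupied set depends on
`(Δ, t_pd, t_pp, t_pp′)`. [folklore] -/
def vhRatio (Δ tpd tpp c : ℝ) : ℝ := fsN tpd tpp c (vhEnergy Δ tpd c) / fsD Δ tpd c (vhEnergy Δ tpd c)

/-- The reduced variable `u = ε_VH(t_pp + t_pp′)/(2(t_pd² − t_pp′ε_VH))`. [folklore] -/
def vhU (Δ tpd tpp c : ℝ) : ℝ := vhEnergy Δ tpd c * (c + tpp) / (2 * (tpd ^ 2 - c * vhEnergy Δ tpd c))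

/-- `fsN(ε) = (t_pp′ + t_pp)(2(t_pd² − t_pp′ε) + ε(t_pp′ + t_pp))`. [folklore] -/
theorem fsN_eq_factor (tpd tpp c ε : ℝ) :
    fsN tpd tpp c ε = (c + tpp) * (2 * (tpd ^ 2 - c * ε) + ε * (c + tpp)) := by
  unfold fsN; ring

/-- **CLOSED FORM `q = u(1 + u)`** (`t_pd² ≠ t_pp′ε_VH`, `t_pd ≠ 0`). [folklore] -/
theorem vhRatio_eq_vhU {Δ tpd tpp c : ℝ} (htpd : tpd ≠ 0) (hw : tpd ^ 2 - c * vhEnergy Δ tpd c ≠ 0) :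
    vhRatio Δ tpd tpp c = vhU Δ tpd tpp c * (1 + vhU Δ tpd tpp c) := by
  have hv := vhEnergy_pos Δ htpd c
  have hvD := vhEnergy_mul_fsD Δ tpd c
  unfold vhRatio vhU
  rw [fsN_eq_factor]
  set v := vhEnergy Δ tpd c
  set w := tpd ^ 2 - c * v
  have hD : fsD Δ tpd c v = 4 * w ^ 2 / v := by
    rw [eq_div_iff hv.ne']; linarith
  rw [hD]
  field_simp
  ring

/-- **`q` IS THE FERMI-SURFACE RATIO AT THE SADDLE ENERGY**: with `ρ = −fsRatio(ε_VH)` (the `−t′/t` of the contour through X,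
`EmeryFermiSurfaceShape`), `q = ρ/(1 − 2ρ)` (`fsD + 2fsN ≠ 0`). [folklore] -/
theorem vhRatio_eq_of_fsRatio {Δ tpd tpp c : ℝ}
    (hT : fsD Δ tpd c (vhEnergy Δ tpd c) + 2 * fsN tpd tpp c (vhEnergy Δ tpd c) ≠ 0) :
    vhRatio Δ tpd tpp c =
      (-fsRatio Δ tpd tpp c (vhEnergy Δ tpd c)) / (1 - 2 * (-fsRatio Δ tpd tpp c (vhEnergy Δ tpd c))) := by
  unfold vhRatio fsRatio
  set D := fsD Δ tpd c (vhEnergy Δ tpd c)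
  set N := fsN tpd tpp c (vhEnergy Δ tpd c)
  have h1 : 1 - 2 * -(-N / (D + 2 * N)) = D / (D + 2 * N) := by field_simp; ring
  have h2 : -(-N / (D + 2 * N)) = N / (D + 2 * N) := by ring
  rw [h1, h2, div_div_div_cancel_right₀ hT]

/-- `charCubic(ε_VH) = fsD(ε_VH) · bilin 4 1 q` (`fsD(ε_VH) ≠ 0`). [folklore] -/
theorem charCubic_vhEnergy_eq_bilin {Δ tpd c : ℝ} (hD : fsD Δ tpd c (vhEnergy Δ tpd c) ≠ 0) (tpp x y : ℝ) :
    charCubic Δ tpd tpp c x y (vhEnergy Δ tpd c) =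
      fsD Δ tpd c (vhEnergy Δ tpd c) * bilin 4 1 (vhRatio Δ tpd tpp c) x y := by
  rw [charCubic_vhEnergy]
  unfold bilin vhRatio
  field_simp

/-! ## §3 The set identity and the factorisation `x_VH = 1 − 2Ψ(q)` -/

/-- THE UNIVERSAL FUNCTION `Ψ(q) = bilinFrac 4 1 q`: the fraction of `[0, π]²` with `1 − x − y − 4q·xy ≥ 0` — the per-spin filling
at which a `t–t′` one-band model with `−t′/t = q/(1 + 2q)` reaches its saddle point. [cite: AndersenEtAl1995, §6 (saddle point of the
`t–t′` form at X)] -/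
def vhFrac (q : ℝ) : ℝ := bilinFrac 4 1 q

/-- `Ψ` is ANTITONE. [folklore] -/
theorem vhFrac_anti {q₁ q₂ : ℝ} (h : q₁ ≤ q₂) : vhFrac q₂ ≤ vhFrac q₁ := bilinFrac_anti_N 4 1 h

/-- `0 ≤ Ψ ≤ 1`. [folklore] -/
theorem vhFrac_mem_Icc (q : ℝ) : vhFrac q ∈ Set.Icc (0 : ℝ) 1 := ⟨bilinFrac_nonneg _ _ _, bilinFrac_le_one _ _ _⟩

/-- **ALWAYS**: the saddle-energy occupied set lies in the bilinear region of its ratio (`fsD(ε_VH) > 0`). [folklore] -/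
theorem abOccSet_vh_subset {Δ tpd c : ℝ} (hD : 0 < fsD Δ tpd c (vhEnergy Δ tpd c)) (tpp : ℝ) :
    abOccSet Δ tpd tpp c (vhEnergy Δ tpd c) ⊆ bilinRegion 4 1 (vhRatio Δ tpd tpp c) := by
  intro k hk
  refine ⟨hk.1, ?_⟩
  have h := charCubic_nonneg_of_abBand_le hk.2
  rw [charCubic_vhEnergy_eq_bilin hD.ne'] at h
  exact nonneg_of_mul_nonneg_right (by linarith) hD

/-- Hence `abFilling(ε_VH) ≤ Ψ(q)` … [folklore] -/
theorem abFilling_vh_le {Δ tpd c : ℝ} (hD : 0 < fsD Δ tpd c (vhEnergy Δ tpd c)) (tpp : ℝ) :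
    abFilling Δ tpd tpp c (vhEnergy Δ tpd c) ≤ vhFrac (vhRatio Δ tpd tpp c) := by
  unfold abFilling vhFrac bilinFrac
  exact div_le_div_of_nonneg_right
    (ENNReal.toReal_mono (volume_bilinRegion_ne_top _ _ _) (measure_mono (abOccSet_vh_subset hD tpp))) (by positivity)

/-- … and `x_VH ≥ 1 − 2Ψ(q)` UNCONDITIONALLY (given `fsD(ε_VH) > 0`). [folklore] -/
theorem xVH_ge {Δ tpd c : ℝ} (hD : 0 < fsD Δ tpd c (vhEnergy Δ tpd c)) (tpp : ℝ) :
    1 - 2 * vhFrac (vhRatio Δ tpd tpp c) ≤ xVH Δ tpd tpp c := by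
  have := abFilling_vh_le hD tpp
  unfold xVH; linarith

/-- THE SEPARATION CONDITION at the saddle energy: `∂_ε charCubic(x, y, ε_VH) ≥ 0` on the triangle `x, y ≥ 0`, `x + y ≤ 1` (which
contains the whole region `{1 − x − y − 4q·xy ≥ 0}`); with `charCubic ≥ 0` and `3ε_VH + cubA ≥ 0` it pins `ε_VH` above the top root.
[folklore] -/
def VHSep (Δ tpd tpp c : ℝ) : Prop :=
  ∀ x y : ℝ, 0 ≤ x → 0 ≤ y → x + y ≤ 1 → 0 ≤ dcharCubic Δ tpd tpp c x y (vhEnergy Δ tpd c)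

/-- **UNDER SEPARATION** the bilinear region lies in the occupied set (`Δ ≥ 0`, `t_pp′ ≥ 0`, `fsD(ε_VH) > 0`, `q ≥ 0`). [folklore] -/
theorem bilinRegion_vh_subset {Δ tpd tpp c : ℝ} (hΔ : 0 ≤ Δ) (hc : 0 ≤ c) (hD : 0 < fsD Δ tpd c (vhEnergy Δ tpd c))
    (hq : 0 ≤ vhRatio Δ tpd tpp c) (hsep : VHSep Δ tpd tpp c) :
    bilinRegion 4 1 (vhRatio Δ tpd tpp c) ⊆ abOccSet Δ tpd tpp c (vhEnergy Δ tpd c) := by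
  intro k hk
  obtain ⟨hquad, hb⟩ := hk
  refine ⟨hquad, ?_⟩
  set x := halfSq k.1
  set y := halfSq k.2
  have hx0 : 0 ≤ x := halfSq_nonneg _
  have hy0 : 0 ≤ y := halfSq_nonneg _
  have hxy1 : x + y ≤ 1 := by
    unfold bilin at hb
    have : 0 ≤ 16 * vhRatio Δ tpd tpp c * (x * y) := by positivity
    linarith
  have h0 : 0 ≤ charCubic Δ tpd tpp c x y (vhEnergy Δ tpd c) := by
    rw [charCubic_vhEnergy_eq_bilin hD.ne']; exact mul_nonneg hD.le hb
  have h1 := hsep x y hx0 hy0 hxy1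
  have h2 : 0 ≤ 3 * vhEnergy Δ tpd c + cubA Δ c x y := by
    have := vhEnergy_nonneg Δ tpd c
    unfold cubA; positivity
  exact abBand_le_of_taylor_nonneg h0 h1 h2

/-- **THE SET IDENTITY**: under separation, `{k : ε_AB(k) ≤ ε_VH} = bilinRegion 4 1 q`. [folklore] -/
theorem abOccSet_vh_eq {Δ tpd tpp c : ℝ} (hΔ : 0 ≤ Δ) (hc : 0 ≤ c) (hD : 0 < fsD Δ tpd c (vhEnergy Δ tpd c))
    (hq : 0 ≤ vhRatio Δ tpd tpp c) (hsep : VHSep Δ tpd tpp c) :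
    abOccSet Δ tpd tpp c (vhEnergy Δ tpd c) = bilinRegion 4 1 (vhRatio Δ tpd tpp c) :=
  Set.Subset.antisymm (abOccSet_vh_subset hD tpp) (bilinRegion_vh_subset hΔ hc hD hq hsep)

/-- … so `abFilling(ε_VH) = Ψ(q)` … [folklore] -/
theorem abFilling_vh_eq {Δ tpd tpp c : ℝ} (hΔ : 0 ≤ Δ) (hc : 0 ≤ c) (hD : 0 < fsD Δ tpd c (vhEnergy Δ tpd c))
    (hq : 0 ≤ vhRatio Δ tpd tpp c) (hsep : VHSep Δ tpd tpp c) :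
    abFilling Δ tpd tpp c (vhEnergy Δ tpd c) = vhFrac (vhRatio Δ tpd tpp c) := by
  unfold abFilling vhFrac bilinFrac
  rw [abOccSet_vh_eq hΔ hc hD hq hsep]

/-- **THE FACTORISATION `x_VH = 1 − 2Ψ(q)`.** [folklore] -/
theorem xVH_eq {Δ tpd tpp c : ℝ} (hΔ : 0 ≤ Δ) (hc : 0 ≤ c) (hD : 0 < fsD Δ tpd c (vhEnergy Δ tpd c))
    (hq : 0 ≤ vhRatio Δ tpd tpp c) (hsep : VHSep Δ tpd tpp c) :
    xVH Δ tpd tpp c = 1 - 2 * vhFrac (vhRatio Δ tpd tpp c) := by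
  unfold xVH; rw [abFilling_vh_eq hΔ hc hD hq hsep]

/-- A `q`-bracket becomes an `x_VH`-window by antitonicity of `Ψ`. [folklore] -/
theorem xVH_mem_Icc_of_vhRatio_mem {Δ tpd tpp c q₁ q₂ : ℝ} (hΔ : 0 ≤ Δ) (hc : 0 ≤ c)
    (hD : 0 < fsD Δ tpd c (vhEnergy Δ tpd c)) (hq : 0 ≤ vhRatio Δ tpd tpp c) (hsep : VHSep Δ tpd tpp c)
    (hmem : vhRatio Δ tpd tpp c ∈ Set.Icc q₁ q₂) :
    xVH Δ tpd tpp c ∈ Set.Icc (1 - 2 * vhFrac q₁) (1 - 2 * vhFrac q₂) := by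
  rw [xVH_eq hΔ hc hD hq hsep]
  exact ⟨by linarith [vhFrac_anti hmem.1], by linarith [vhFrac_anti hmem.2]⟩

end Summit.Ventures.CertifiedManyBodySolver.Downfold.Emery
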